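import Literature.NumberTheory.EllipticCurves.HeathBrown1994.CongruentTwoSelmerMonskyMatrix
import Mathlib.Analysis.SpecialFunctions.Pow.Real

/-!
# Sketch — crux idea `sign-table-character-dichotomy` (crux-ideate seat 2, g24) for
`HeegnerTwistCouplingInSupply` (stmt-BirchSwinnertonDyer-21381).

First checkable statements of the line, over existing declarations only
(`monskyMatrixOdd`, `jacobiSym`, Mathlib reals). Nothing is proved here.
-/

namespace Summit.BirchSwinnertonDyer.BirchSwinnertonDyer.Cruxes.HeegnerTwistCouplingInSupply.SignTableDichotomy

open Literature.NumberTheory.EllipticCurves.HeathBrown1994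

/-- **Lemma B (Burgess–Vinogradov window), existence form.** For every `δ > 0` there are `A, x₀` such that for
every squarefree `D ≠ 1` and every `x ≥ max x₀ |D|^{1/4+δ}` some prime `q` with
`x^{1/(A log log x)} < q ≤ x` has `(D/q) = −1`.  (Burgess for cube-free conductor + Vinogradov's trick with a
`w`-smooth head + fundamental lemma; all constants effective.) -/
def NonresiduePrimeWindow : Prop :=
  ∀ δ : ℝ, 0 < δ → ∃ A x₀ : ℝ, 0 < A ∧ ∀ D : ℤ, D ≠ 1 → Squarefree D →
    ∀ x : ℝ, x₀ ≤ x → ((D.natAbs : ℕ) : ℝ) ^ (1 / 4 + δ) ≤ x →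
      ∃ q : ℕ, q.Prime ∧ x ^ (1 / (A * Real.log (Real.log x))) < (q : ℝ) ∧ (q : ℝ) ≤ x ∧
        jacobiSym D q = -1

/-- **Lemma B, harmonic-mass form** (what the sieve step actually consumes): the primes `q ∈ (w, x]` with
`(D/q) = −1` have `∑ 1/q ≥ c / log² w` whenever `2 ≤ w ≤ x^{1/(A log log x)}` and `x ≥ max x₀ |D|^{1/4+δ}`. -/
def NonresiduePrimeMass : Prop :=
  ∀ δ : ℝ, 0 < δ → ∃ A c x₀ : ℝ, 0 < A ∧ 0 < c ∧ ∀ D : ℤ, D ≠ 1 → Squarefree D →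
    ∀ x w : ℝ, x₀ ≤ x → ((D.natAbs : ℕ) : ℝ) ^ (1 / 4 + δ) ≤ x → 2 ≤ w →
      w ≤ x ^ (1 / (A * Real.log (Real.log x))) →
        c / (Real.log w) ^ 2 ≤
          ∑ q ∈ (Finset.Icc ⌈w⌉₊ ⌊x⌋₊).filter (fun q => q.Prime ∧ jacobiSym D q = -1), (1 : ℝ) / (q : ℝ)

/-- **Transfer statement `C⁺_game(k = 1, odd)`** — the output of the sign-table game for the two-parameter corner
family `W = E_{p r}` (`r` a fixed odd prime, `p ≡ 3 (4)`, root number `−1`): for `p ≥ p₀(r)` there are distinct odd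
primes `q₁ … q_t ∉ {p, r}` with `d = −q₁⋯q_t ≡ 1 (8)`, `(d/p) = (d/r) = +1` (Heegner for `32 p² r²`),
`√|d|·log|d| < π p` (so `h(ℚ(√d)) < p`, tree lemma `not_dvd_classNumber_of_sqrt_mul_log_lt_pi_mul`) and Monsky's odd
determinant `det M(p, r, q₁, …, q_t) = 1` (so `# Sel₂(E_{p r |d|}) = 4`, tree door
`card_selmerGroup_two_eq_four_of_det_odd'`, hence `L(E_{p r |d|}, 1) ≠ 0` modulo Burungale–Tian). -/
def GameClosureK1Odd : Prop :=
  ∀ r : ℕ, r.Prime → r % 2 = 1 → ∃ p₀ : ℕ, ∀ p : ℕ, p.Prime → p % 4 = 3 → p ≠ r → p₀ ≤ p →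
    ((p * r) % 8 = 5 ∨ (p * r) % 8 = 7) →
      ∃ (t : ℕ) (q : Fin t → ℕ),
        (∀ i, (q i).Prime ∧ q i % 2 = 1 ∧ q i ≠ p ∧ q i ≠ r) ∧ Function.Injective q ∧
        (∏ i, q i) % 8 = 7 ∧
        jacobiSym (-((∏ i, q i : ℕ) : ℤ)) p = 1 ∧ jacobiSym (-((∏ i, q i : ℕ) : ℤ)) r = 1 ∧
        Real.sqrt ((∏ i, q i : ℕ) : ℝ) * Real.log ((∏ i, q i : ℕ) : ℝ) < Real.pi * p ∧
        (monskyMatrixOdd (Fin.cons p (Fin.cons r q : Fin (t + 1) → ℕ) : Fin (t + 1 + 1) → ℕ)).det = 1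

/-- **Transfer statement `C⁺_game(k = 0)`** — the one-parameter corner `W = E_p`, `p ≡ 7 (8)` (already closed for ALL
`p` in the tree by the rounding pin; recorded here because the game reproduces it for `p ≥ p₀` WITHOUT a pin, and
the `k = 0` census is the base case of the dichotomy). -/
def GameClosureK0 : Prop :=
  ∃ p₀ : ℕ, ∀ p : ℕ, p.Prime → p % 8 = 7 → p₀ ≤ p →
    ∃ (t : ℕ) (q : Fin t → ℕ),
      (∀ i, (q i).Prime ∧ q i % 2 = 1 ∧ q i ≠ p) ∧ Function.Injective q ∧
      (∏ i, q i) % 8 = 7 ∧ jacobiSym (-((∏ i, q i : ℕ) : ℤ)) p = 1 ∧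
      Real.sqrt ((∏ i, q i : ℕ) : ℝ) * Real.log ((∏ i, q i : ℕ) : ℝ) < Real.pi * p ∧
      (monskyMatrixOdd (Fin.cons p q : Fin (t + 1) → ℕ)).det = 1

end Summit.BirchSwinnertonDyer.BirchSwinnertonDyer.Cruxes.HeegnerTwistCouplingInSupply.SignTableDichotomy
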